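import Summits.QuantumAdvantage.QuantumAdvantage.Theses.LinnikCubicClassGroups
import Summits.QuantumAdvantage.QuantumAdvantage.Theorems.LinnikCubicClassGroupsPureCubicClassGroupFBQPStubCubicFieldFacts
import Summits.QuantumAdvantage.QuantumAdvantage.Theorems.LinnikCubicClassGroupsPureCubicClassGroupFBQPStubAssemblyCore
import Summits.QuantumAdvantage.QuantumAdvantage.Theorems.LinnikCubicClassGroupsPureCubicClassGroupFBQPStubAssemblyCoins
import Summits.QuantumAdvantage.QuantumAdvantage.Theorems.LinnikCubicClassGroupsPureCubicClassGroupFBQPStubAssemblyFields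
import Literature.Computability.Cryptography.ShorAssemblyLeavesProofs
import Literature.Computability.QuantumComplexity.CWrapAssembly
import Literature.Computability.QuantumComplexity.BQPJoinClosure
import Literature.Computability.Complexity.OracleJoin
import Literature.Computability.Complexity.PromiseCookMachine

/-!
# Crux `LinnikCubicClassGroups.PureCubicClassGroupFBQP` (stmt-QuantumAdvantage-11544) — stub `stub_assembly`

Line `arakelov-giant-step-cycle`, stub S6 (skeleton v6): the **assembly** of the randomised classical wrap
into the canonical relation `Rcanon` from its four registered pieces — S6a (the two `FP` programs of the
quantum-core language), S6b (the bit-graph language of the prime factorisation is in `BQP`; the sampler is ONE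
`FP`-function relative to the join of that language and the core language), S6c (the `3/4` coin bound), S6d
(class numbers and core answers agree across admissible fields) — and the three hypotheses of the line, S4a
(facts on pure cubic fields), S4b (counts, with its constant `C`) and S5b (the quantum core, `IsQSolvable`).

Proof (the tree's PROVED classical-base principle `isQSolvable_of_mem_FPRel_BQP_holds`, "`BPP^{BQP}` search
`⊆ FBQP`", `ShorAssemblyLeavesProofs.lean`):
1. `ord m ps` := S5b's answer (order of the subgroup of `Cl(𝓞 K)` generated by the degree-one classes above
   `ps`) in a CHOSEN admissible `K` — a function of `(m, ps)` by S6d (2) (`Classical.choose`, no definition);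
2. the core language `coreLang(ord)` is in `BQP`: the classical wrap (`isQSolvable_classicalWrap_holds`) of
   S5b's family by S6a's programs solves "output the bit `[u ∈ coreLang(ord)]`" (on the promise the
   pre-processor's input is well formed, an admissible field exists by S4a (0), and S5b's output decodes to
   `ord m ps`), whence `mem_BQP_of_isQSolvable_bit`;
3. the oracle `FACTBITS ⊕ coreLang(ord)` is in `BQP` (S6b (1) and the tree's `oracleJoin_mem_BQP`, BBBV Cor. 4.15);
4. the sampler `G` of S6b (2) lands in `Rcanon x` with probability `≥ 3/4` over the coins: for a cube `m` it
   writes the zero word (probability `1`); otherwise, whenever the accepted primes generate `Cl(𝓞 K₀)` for one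
   admissible `K₀` (S4a (0)) — probability `≥ 3/4` by S6c — its word is `bin` of
   `ord m ps = |Cl(𝓞 K₀)| = h(K₀) = h(K)` for every admissible `K` (S6d (1)), truncated to `2|x|+8` bits.
-/

set_option linter.dupNamespace false

namespace Summit.QuantumAdvantage.QuantumAdvantage.Theorems.LinnikCubicClassGroups

open Computability (encodeNat decodeNat)
open Literature.Computability.Cryptography (IsQSolvable QCircuitFamily cliffordT BQP
  isQSolvable_of_mem_FPRel_BQP_holds isQSolvable_classicalWrap_holds)
open Literature.Computability.Complexity (boolPair boolUnpair boolUnpair_boolPair encodingListNatBool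
  uniformProb uniformProb_univ FP FPRel Oracle oracleJoin bitsToNat)
open scoped NumberField nonZeroDivisors

/-- **S6 `stub_assembly`** (skeleton v7 signature, < 4 KB: the ledger truncates longer stub signatures): S6b →
S4b-conclusion → S5b-conclusion → `IsQSolvable Rcanon`; the LANDED pieces S6a, S6c, S6d and S4a are imported. -/
theorem stub_assembly :
    ({u : List Bool | ∃ (x : List Bool) (i : ℕ), u = boolPair x (encodeNat i) ∧
        ((encodingListNatBool.encode (decodeNat x).primeFactorsList).flatMap (fun b => [true, b])).getD i false =
          true} ∈ BQP ∧
    ∀ (C : ℕ) (ord : ℕ → List ℕ → ℕ), ∃ G : List Bool → List Bool,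
      G ∈ FPRel (Oracle.ofLanguage (oracleJoin
        {u : List Bool | ∃ (x : List Bool) (i : ℕ), u = boolPair x (encodeNat i) ∧
          ((encodingListNatBool.encode (decodeNat x).primeFactorsList).flatMap (fun b => [true, b])).getD i false =
            true}
        {u : List Bool | ∃ (x : List Bool) (qs ps : List ℕ) (i : ℕ),
          u = boolPair (boolPair x (boolPair (encodingListNatBool.encode qs) (encodingListNatBool.encode ps)))
            (encodeNat i) ∧
          (∀ q ∈ qs, q.Prime) ∧ qs.prod = decodeNat x ∧ (¬ ∃ r : ℕ, r ^ 3 = decodeNat x) ∧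
          (∀ p ∈ ps, p.Prime ∧ ¬ p ∣ 3 * decodeNat x) ∧ (ord (decodeNat x) ps).testBit i = true})) ∧
      ∀ x c : List Bool,
        ((∃ r : ℕ, r ^ 3 = decodeNat x) → G (boolPair x c) = List.replicate (2 * x.length + 8) false) ∧
        ((∀ r : ℕ, r ^ 3 ≠ decodeNat x) → G (boolPair x c) =
          List.ofFn (fun i : Fin (2 * x.length + 8) => (ord (decodeNat x)
            (((List.range (600 * (Nat.log 2 ((27 * decodeNat x ^ 2) ^ C) + 1) ^ 2)).filterMap fun k =>
              ((List.range (38400 * (Nat.log 2 ((27 * decodeNat x ^ 2) ^ C) + 1) ^ 3)).map fun j =>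
                bitsToNat ((c.drop ((k * (38400 * (Nat.log 2 ((27 * decodeNat x ^ 2) ^ C) + 1) ^ 3) + j) *
                  (Nat.log 2 ((27 * decodeNat x ^ 2) ^ C) + 1))).take
                  (Nat.log 2 ((27 * decodeNat x ^ 2) ^ C) + 1))).find? fun v =>
                decide (v.Prime ∧ v ≤ (27 * decodeNat x ^ 2) ^ C ∧ ¬ v ∣ 3 * decodeNat x)))).testBit i.val))) →
    (∃ C : ℕ, ∀ (K : Type) [Field K] [NumberField K],
      Module.finrank ℚ K = 3 → ∀ m : ℕ, (∀ r : ℕ, r ^ 3 ≠ m) → (∃ α : K, α ^ 3 = (m : K)) →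
      ∀ X : ℕ, (27 * m ^ 2) ^ C ≤ X →
        X ≤ 4 * (Nat.log 2 X + 1) * Nat.card {p : ℕ // p.Prime ∧ p ≤ X ∧ ¬ p ∣ 3 * m} ∧
        ∀ T : ℕ, 600 * (Nat.log 2 X + 1) ^ 2 ≤ T →
          8 * Nat.card {v : Fin T → {p : ℕ // p.Prime ∧ p ≤ X ∧ ¬ p ∣ 3 * m} //
              Subgroup.closure {c : ClassGroup (𝓞 K) | ∃ i : Fin T, ∃ P : Ideal (𝓞 K),
                ∃ hP : P ∈ nonZeroDivisors (Ideal (𝓞 K)),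
                  P.IsPrime ∧ Ideal.absNorm P = (v i : ℕ) ∧ c = ClassGroup.mk0 ⟨P, hP⟩} ≠ ⊤} ≤
            Nat.card {p : ℕ // p.Prime ∧ p ≤ X ∧ ¬ p ∣ 3 * m} ^ T) →
    (IsQSolvable fun w => {y | ∀ (x : List Bool) (f a b : ℕ) (ps : List ℕ),
        w = boolPair x (boolPair (boolPair (encodeNat f) (boolPair (encodeNat a) (encodeNat b)))
          (encodingListNatBool.encode ps)) →
        decodeNat x = f ^ 3 * (a * b ^ 2) → Squarefree (a * b) →
        ∀ (K : Type) [Field K] [NumberField K], Module.finrank ℚ K = 3 →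
          (∀ r : ℕ, r ^ 3 ≠ decodeNat x) → (∃ α : K, α ^ 3 = (decodeNat x : K)) →
          (∀ p ∈ ps, p.Prime ∧ ¬ p ∣ 3 * decodeNat x) →
          ∃ t : List Bool, y = boolPair (encodeNat (Nat.card (Subgroup.closure
            {c : ClassGroup (𝓞 K) | ∃ p ∈ ps, ∃ P : Ideal (𝓞 K), ∃ hP : P ∈ nonZeroDivisors (Ideal (𝓞 K)),
              P.IsPrime ∧ Ideal.absNorm P = p ∧ c = ClassGroup.mk0 ⟨P, hP⟩}))) t}) →
    IsQSolvable fun x => {y | ∃ v : List Bool, v.length = 2 * x.length + 8 ∧ v <+: y ∧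
      (∀ (K : Type) [Field K] [NumberField K], Module.finrank ℚ K = 3 →
        (∀ r : ℕ, r ^ 3 ≠ decodeNat x) → (∃ α : K, α ^ 3 = (decodeNat x : K)) →
        v = List.ofFn (fun i : Fin (2 * x.length + 8) => (NumberField.classNumber K).testBit i.val)) ∧
      ((¬ ∃ (K : Type) (_ : Field K) (_ : NumberField K), Module.finrank ℚ K = 3 ∧
          (∀ r : ℕ, r ^ 3 ≠ decodeNat x) ∧ ∃ α : K, α ^ 3 = (decodeNat x : K)) →
        v = List.replicate (2 * x.length + 8) false)} := by
  rintro ⟨hFL, hsampler⟩ ⟨C, hC⟩ hcore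
  obtain ⟨⟨h, hh, hH⟩, ⟨g, hg, hG⟩⟩ := stub_assemblyCore
  have hcoins := stub_assemblyCoins
  have hfacts := stub_cubicFieldFacts
  have hfields := stub_assemblyFields ⟨C, hC⟩ hcore
  classical
  /- 1. the core's answer as a function `ord m ps` -/
  have key : ∀ (m : ℕ) (ps : List ℕ), ∃ n : ℕ, ∀ x : List Bool, decodeNat x = m →
      (∀ p ∈ ps, p.Prime ∧ ¬ p ∣ 3 * decodeNat x) → (∀ r : ℕ, r ^ 3 ≠ decodeNat x) →
      ∀ (K : Type) [Field K] [NumberField K], Module.finrank ℚ K = 3 → (∃ α : K, α ^ 3 = (decodeNat x : K)) →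
        n = Nat.card (Subgroup.closure {c : ClassGroup (𝓞 K) | ∃ p ∈ ps, ∃ P : Ideal (𝓞 K),
          ∃ hP : P ∈ nonZeroDivisors (Ideal (𝓞 K)), P.IsPrime ∧ Ideal.absNorm P = p ∧ c = ClassGroup.mk0 ⟨P, hP⟩}) := by
    intro m ps
    by_cases hex : ∃ (K : Type) (_ : Field K) (_ : NumberField K), Module.finrank ℚ K = 3 ∧
        (∀ r : ℕ, r ^ 3 ≠ m) ∧ ∃ α : K, α ^ 3 = (m : K)
    · obtain ⟨K₀, _, _, hK₀, hnc₀, hα₀⟩ := hex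
      refine ⟨Nat.card (Subgroup.closure {c : ClassGroup (𝓞 K₀) | ∃ p ∈ ps, ∃ P : Ideal (𝓞 K₀),
          ∃ hP : P ∈ nonZeroDivisors (Ideal (𝓞 K₀)), P.IsPrime ∧ Ideal.absNorm P = p ∧ c = ClassGroup.mk0 ⟨P, hP⟩}),
        fun x hx hps hnc K _ _ hK hα => ?_⟩
      subst hx
      exact (hfields x hnc K₀ K hK₀ hα₀ hK hα).2 ps hps
    · refine ⟨0, fun x hx hps hnc K _ _ hK hα => (hex ⟨K, ‹Field K›, ‹NumberField K›, hK, ?_, ?_⟩).elim⟩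
      · subst hx; exact hnc
      · subst hx; exact hα
  choose ord hord using key
  /- 2. the core language of `ord` is in `BQP` -/
  set CL : Language Bool := {u : List Bool | ∃ (x : List Bool) (qs ps : List ℕ) (i : ℕ),
      u = boolPair (boolPair x (boolPair (encodingListNatBool.encode qs) (encodingListNatBool.encode ps)))
        (encodeNat i) ∧
      (∀ q ∈ qs, q.Prime) ∧ qs.prod = decodeNat x ∧ (¬ ∃ r : ℕ, r ^ 3 = decodeNat x) ∧
      (∀ p ∈ ps, p.Prime ∧ ¬ p ∣ 3 * decodeNat x) ∧ (ord (decodeNat x) ps).testBit i = true}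
  -- on the promise, S5b's output on the pre-processor's input decodes to `ord m ps`
  have hdecode : ∀ (x : List Bool) (qs ps : List ℕ) (i : ℕ) (y : List Bool), (∀ q ∈ qs, q.Prime) →
      qs.prod = decodeNat x → (¬ ∃ r : ℕ, r ^ 3 = decodeNat x) → (∀ p ∈ ps, p.Prime ∧ ¬ p ∣ 3 * decodeNat x) →
      y ∈ (fun w => {y | ∀ (x : List Bool) (f a b : ℕ) (ps : List ℕ),
        w = boolPair x (boolPair (boolPair (encodeNat f) (boolPair (encodeNat a) (encodeNat b)))
          (encodingListNatBool.encode ps)) →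
        decodeNat x = f ^ 3 * (a * b ^ 2) → Squarefree (a * b) →
        ∀ (K : Type) [Field K] [NumberField K], Module.finrank ℚ K = 3 →
          (∀ r : ℕ, r ^ 3 ≠ decodeNat x) → (∃ α : K, α ^ 3 = (decodeNat x : K)) →
          (∀ p ∈ ps, p.Prime ∧ ¬ p ∣ 3 * decodeNat x) →
          ∃ t : List Bool, y = boolPair (encodeNat (Nat.card (Subgroup.closure
            {c : ClassGroup (𝓞 K) | ∃ p ∈ ps, ∃ P : Ideal (𝓞 K), ∃ hP : P ∈ nonZeroDivisors (Ideal (𝓞 K)),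
              P.IsPrime ∧ Ideal.absNorm P = p ∧ c = ClassGroup.mk0 ⟨P, hP⟩}))) t})
        (h (boolPair (boolPair x (boolPair (encodingListNatBool.encode qs) (encodingListNatBool.encode ps)))
          (encodeNat i))) →
      decodeNat (boolUnpair y).1 = ord (decodeNat x) ps := by
    intro x qs ps i y hprime hprod hcube hps hy
    have hnc : ∀ r : ℕ, r ^ 3 ≠ decodeNat x := fun r hr => hcube ⟨r, hr⟩
    obtain ⟨K₀, _, _, hK₀, hα₀⟩ := (hfacts _ hnc).1
    obtain ⟨f, a, b, hfab, hspec⟩ := hH x qs ps i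
    obtain ⟨hdec, hsq⟩ := hspec hprime
    rw [hfab] at hy
    obtain ⟨t, rfl⟩ := hy x f a b ps rfl (hprod.symm.trans hdec) hsq K₀ hK₀ hnc hα₀ hps
    rw [boolUnpair_boolPair, Computability.decode_encodeNat]
    exact (hord (decodeNat x) ps x rfl hps hnc K₀ hK₀ hα₀).symm
  have hbit : IsQSolvable fun u => {z | [decide (u ∈ CL)] <+: z} := by
    refine (isQSolvable_classicalWrap_holds h g hh hg hcore).mono fun u z hz => ?_
    obtain ⟨y, hy, hz⟩ := hz
    obtain ⟨bit, hgb, hiff⟩ := hG u y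
    rw [hgb] at hz
    have hiff' : bit = true ↔ u ∈ CL := by
      rw [hiff]
      constructor
      · rintro ⟨x, qs, ps, i, rfl, hprime, hprod, hcube, hps, hb⟩
        refine ⟨x, qs, ps, i, rfl, hprime, hprod, hcube, hps, ?_⟩
        rwa [hdecode x qs ps i y hprime hprod hcube hps hy] at hb
      · rintro ⟨x, qs, ps, i, rfl, hprime, hprod, hcube, hps, hb⟩
        refine ⟨x, qs, ps, i, rfl, hprime, hprod, hcube, hps, ?_⟩
        rwa [hdecode x qs ps i y hprime hprod hcube hps hy]
    have hbd : bit = decide (u ∈ CL) := by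
      cases bit
      · exact (decide_eq_false fun hP => Bool.false_ne_true (hiff'.2 hP)).symm
      · exact (decide_eq_true (hiff'.1 rfl)).symm
    rwa [hbd] at hz
  have hCL : CL ∈ BQP :=
    Literature.Computability.Cryptography.mem_BQP_of_isQSolvable_bit
      (fun _ _ => Literature.Computability.Cryptography.QCircuit.outputPMF_apply_holds)
      Literature.Computability.Cryptography.cliffordT_isUnitary_holds (fun u => decide_eq_true_iff) hbit
  /- 3. the oracle, 4. the sampler and its coin bound -/
  have hJ := Literature.Computability.QuantumComplexity.oracleJoin_mem_BQP hFL hCL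
  obtain ⟨G, hGrel, hGspec⟩ := hsampler C ord
  obtain ⟨q, hq⟩ := hcoins C hC
  refine isQSolvable_of_mem_FPRel_BQP_holds _ G q _ (fun x y hy z hyz => ?_) hJ hGrel fun x => ?_
  · obtain ⟨v, hlen, hvy, hall, hnone⟩ := hy
    exact ⟨v, hlen, hvy.trans hyz, hall, hnone⟩
  by_cases hcube : ∃ r : ℕ, r ^ 3 = decodeNat x
  · -- cube: the zero word, probability one
    refine le_trans (by norm_num) (le_of_eq (uniformProb_univ (q.eval x.length)).symm) |>.trans
      (Literature.Computability.Complexity.PromiseCook.uniformProb_mono fun c _ => ?_)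
    obtain ⟨r, hr⟩ := hcube
    refine ⟨_, List.length_replicate, ?_, fun K _ _ _ hnc _ => (hnc r hr).elim, fun _ => rfl⟩
    rw [(hGspec x c).1 ⟨r, hr⟩]
  · -- non-cube: generation of the class group of one admissible field suffices
    push Not at hcube
    obtain ⟨K₀, _, _, hK₀, hα₀⟩ := (hfacts _ hcube).1
    refine le_trans (hq x hcube K₀ hK₀ hα₀) (Literature.Computability.Complexity.PromiseCook.uniformProb_mono fun c hc => ?_)
    rw [Set.mem_setOf_eq] at hc ⊢
    rw [(hGspec x c).2 hcube]
    refine ⟨_, List.length_ofFn, List.prefix_rfl, fun K _ _ hK _ hα => ?_,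
      fun hno => (hno ⟨K₀, ‹Field K₀›, ‹NumberField K₀›, hK₀, hcube, hα₀⟩).elim⟩
    have hgood : ∀ p ∈ ((List.range (600 * (Nat.log 2 ((27 * decodeNat x ^ 2) ^ C) + 1) ^ 2)).filterMap fun k =>
        ((List.range (38400 * (Nat.log 2 ((27 * decodeNat x ^ 2) ^ C) + 1) ^ 3)).map fun j =>
          bitsToNat ((c.drop ((k * (38400 * (Nat.log 2 ((27 * decodeNat x ^ 2) ^ C) + 1) ^ 3) + j) *
            (Nat.log 2 ((27 * decodeNat x ^ 2) ^ C) + 1))).take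
            (Nat.log 2 ((27 * decodeNat x ^ 2) ^ C) + 1))).find? fun v =>
          decide (v.Prime ∧ v ≤ (27 * decodeNat x ^ 2) ^ C ∧ ¬ v ∣ 3 * decodeNat x)),
        p.Prime ∧ ¬ p ∣ 3 * decodeNat x := by
      intro p hp
      obtain ⟨k, -, hk⟩ := List.mem_filterMap.1 hp
      have hp' := List.find?_some hk
      rw [decide_eq_true_eq] at hp'
      exact ⟨hp'.1, hp'.2.2⟩
    rw [hord (decodeNat x) _ x rfl hgood hcube K₀ hK₀ hα₀, hc, Subgroup.card_top, Nat.card_eq_fintype_card,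
      ← (hfields x hcube K₀ K hK₀ hα₀ hK hα).1]
    rfl

end Summit.QuantumAdvantage.QuantumAdvantage.Theorems.LinnikCubicClassGroups
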